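import Summits.QuantumFields.YangMills.Theorems.BalabanUVNodesN09ChartReadAveragingSmooth
import Summits.QuantumFields.YangMills.Theorems.FluctuationComparisonRegPrIntLWregChain
import HarnessLib

/-!
# S2β · LAPLACE row — (C2-a): THE PIVOT-READ OF THE ITERATED AVERAGING IS JOINTLY `C^∞` ALONG A SMOOTH FAMILY (pen w5-20520 g14)

Cell `ym3-torus` (rung R3: continuum `SU(2)` Yang–Mills on `T³` — NOT `d = 4`, NOT infinite volume, NOT a mass gap, NOT Clay); width seat `ym-ust-20520-w5` g14;
helper of the crux `stmt-QuantumFields-20520` (`--supports`, NOT a proof of it).  THEOREMS ONLY (0 `def`, 0 `sorry`; default heartbeats); generic `(P, N)`.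

WHY.  The v8 docking of `Lines/semiclassical_s2beta.lean` (w4-20520 g15, LINE OWNER WORD 12) displays the Peano row of the LAPLACE organ as
`ContDiffAt ℝ 2 (fun y => wilsonAction4 (c.Φ (V, σ y))) 0` for the window chart of record `c` (w3-20520 g14) and the tubular transversal `σ` (px21 g9); px11 g10's
LOCATE reduces it to the IMPLICIT-FUNCTION statement (C2): `c.Φ (V, ·)` RE-SOLVES the pivots `βₙ := iterCentralBond n` (`n = K − J`) of the `n`-fold (0.4) averaging
`Ū⁽ⁿ⁾`, so along `σ` the pivot values are the zero set of the PIVOT-READ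
  `R(z, X) := (c ↦ Λ(Ū⁽ⁿ⁾(z[βₙ c' ↦ Θ(X c')·U₀(βₙ c')]) c · (Ū⁽ⁿ⁾ U₀ c)⁻¹))`,  `z = σ y`,  `X : PBond P n → 𝔰𝔲(N)`
(`Θ ∕ Λ` = the exponential ∕ logarithmic charts of `SU(N)` of record, `isChartRep_specialUnitaryGroup`).  (C2) = (C2-a) `R ∘ (σ × id)` is `C^∞` at `(0, 0)` [THIS FILE]
+ (C2-b) its pivot-derivative is invertible [px11 g10] + (C2-c) lit ✓`FixedPointSmoothDependence.contDiffAt_of_implicitZero'` [w5, next file].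

WHAT.  No chart-reads at intermediate levels are needed: lit ✓`Node00.AveragingSmooth` carries the AMBIENT iterate `iterM n` of matrix fields with
`↑(Ū⁽ⁿ⁾ W) = iterM n ↑W` under the guard `SmallBelow n W` and `C^∞` at `↑U₀` (`coeField_iter_eq_iterM`, `contDiffAt_iterM`).  §1 `extend` letters (no injectivity
needed); §2 the guard `SmallBelow n` is OPEN and `Ū⁽ⁿ⁾` is continuous on it; §3 the ambient pivot field `(y, X) ↦ ↑(σ y)[βₙ c' ↦ e^{X c'}·↑U₀(βₙ c')]` is `C^∞`;
§4 ★★ `contDiffAt_pivotRead`: for `σ` continuous with `σ 0 = U₀`, `ContDiffAt ℝ ⊤ (fun y => coeField (σ y)) 0` (px21 ✓p739948's row, pointwise) and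
`SmallBelow n U₀`, the pivot-read `(y, X) ↦ R(σ y, X)` is `C^∞` at `(0, 0)` (near `(0,0)` its matrix is `mlog (iterM n (ambient field) c · (↑Ū⁽ⁿ⁾U₀ c)⋆)`, `mlog`
analytic at `1`; `contDiffAt_of_coe`); §5 the value `R(U₀, 0) = 0` and ★ THE DOCKING IDENTITY for (C2-b):
`R(U₀, X) c = Λ(chainMap ℰ n U₀ c (Θ(X c)·U₀(βₙ c)) · (Ū⁽ⁿ⁾ U₀ c)⁻¹)` (triangularity ✓`isLocal_iter_blockAvg` ∘ ✓`apply_resample_eq`) — px11's one-variable chart-read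
chain at `X c`, so `∂_X R(U₀, ·)(0)` is block-diagonal over the coarse bonds.

HONEST SCOPE.  Calculus on the tree's own averaging; proves no stub; EXW ∕ GAP♯ ∕ DECAY ∕ LAPLACE ∕ S2β ∕ the crux 20520 NOT proved; `YM3TorusSU2` NOT proved;
the Yang–Mills mass gap (Clay) NOT proved.

References: [Balaban1987RG1] CMP 109 (1987) (0.4) p. 253 («we assume that it is an analytic function»), (0.11)/(0.21) pp. 253–256, p. 267 (after (2.10));
[Balaban1985Variational] CMP 102 (1985) Thm 1 (8)–(10) p. 279; [Helgason2000] Ch. I §1 Thm 1.14 p. 96; [Dieudonne1960] Ch. X §2 (10.2.1)–(10.2.3).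
-/

noncomputable section

open scoped Matrix.Norms.L2Operator Topology ContDiff
open Filter Set Function
open Literature.MathematicalPhysics.QuantumFieldTheory.Balaban1983to89
open Literature.MathematicalPhysics.QuantumFieldTheory.Balaban1983to89.HaarExponentialChart
open Literature.MathematicalPhysics.QuantumFieldTheory.Balaban1983to89.HaarExponentialChart.IsChartRep
open Literature.MathematicalPhysics.QuantumFieldTheory.Balaban1983to89.BlockAveraging (Small Idx avgFun loopHol blockAvg blockAvg_avg)
open Literature.MathematicalPhysics.QuantumFieldTheory.Balaban1983to89.ExpMeanLog (expMeanLogSU deltaSU)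
open Literature.MathematicalPhysics.QuantumFieldTheory.Balaban1983to89.Node00
open Literature.MathematicalPhysics.QuantumFieldTheory.Balaban1983to89.T4TriangularPushforward (IsLocal apply_resample_eq)
open Literature.MathematicalPhysics.QuantumLattice (fundamentalRep fundamentalRep_apply)
open MatrixLog (mlog analyticAt_mlog mlog_one)
open Summit.QuantumFields.YangMills.BalabanUVNodes.N09ChartReadAveragingSmooth (contDiffAt_of_coe continuousAt_avgFun_of_small)
open Summit.QuantumFields.YangMills.Theorems.FluctuationComparisonRegPrIntLWregChain (iterCentralBond iterCentralBond_injective isLocal_iter_blockAvg chainMap)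

namespace Summit.QuantumFields.YangMills.Theorems.FluctuationComparisonRegPrIntLS2BetaPivotReadSmooth

/-! ## §1 `extend` letters (no injectivity of the pivot map is needed) -/

section Extend

variable {ι κ G : Type*}

/-- Resampling a function along `β` BY ITS OWN VALUES changes nothing: `extend β (U ∘ β) U = U`. [folklore] -/
theorem extend_comp_apply_self (β : κ → ι) (U : ι → G) : extend β (fun c => U (β c)) U = U := by
  classical
  funext b
  rw [Function.extend_def]
  split_ifs with h
  · rw [Classical.choose_spec h]
  · rfl

/-- `extend` commutes with a pointwise map applied to both the inserted values and the background. [folklore] -/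
theorem map_extend_eq {H : Type*} (φ : G → H) (β : κ → ι) (g : κ → G) (U : ι → G) :
    (fun b => φ (extend β g U b)) = extend β (fun c => φ (g c)) (fun b => φ (U b)) := by
  classical
  funext b
  simp only [Function.extend_def]
  split_ifs <;> rfl

end Extend

/-! ## §2 The guard `SmallBelow n` is open, and the iterated averaging is continuous on it -/

section Guard

variable {P : Params} {N : ℕ} [NeZero N]

/-- **THE GUARD BELOW `n` IS OPEN AND `Ū⁽ⁿ⁾` IS CONTINUOUS ON IT**: at a configuration whose successive averages `Ū⁽ᵏ⁾`, `k < n`, satisfy the (0.4) small-field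
condition at every coarse bond, `Ū⁽ⁿ⁾` is continuous (✓`continuousAt_avgFun_of_small` level by level) and the same guard holds at every nearby configuration
(finitely many strict inequalities in continuous loop variables). [cite: Balaban1987RG1, (0.4) p.253 and (0.21) p.256] -/
theorem continuousAt_iter_and_eventually_smallBelow :
    ∀ (n : ℕ) (U₀ : GaugeField P 0 (SU N)), SmallBelow (fun j => blockAvg (P := P) (j := j) (expMeanLogSU (n := Fin N))) n U₀ →
      ContinuousAt (Averaging.iter (fun j => blockAvg (P := P) (j := j) (expMeanLogSU (n := Fin N))) n) U₀ ∧
        ∀ᶠ U in 𝓝 U₀, SmallBelow (fun j => blockAvg (P := P) (j := j) (expMeanLogSU (n := Fin N))) n U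
  | 0, U₀, _ => ⟨continuousAt_id, Filter.Eventually.of_forall fun _ j hj => absurd hj (Nat.not_lt_zero j)⟩
  | n + 1, U₀, h => by
      obtain ⟨hcont, hev⟩ := continuousAt_iter_and_eventually_smallBelow n U₀ (h.mono (Nat.le_succ n))
      have hsmall : ∀ c, Small (expMeanLogSU (n := Fin N)) (Averaging.iter (fun j => blockAvg (P := P) (j := j) (expMeanLogSU (n := Fin N))) n U₀) c :=
        fun c => h n (Nat.lt_succ_self n) c
      -- continuity of `Ū⁽ⁿ⁺¹⁾ = Ū ∘ Ū⁽ⁿ⁾`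
      have hstep : ContinuousAt (avgFun (expMeanLogSU (n := Fin N)) : GaugeField P n (SU N) → GaugeField P (n + 1) (SU N))
          (Averaging.iter (fun j => blockAvg (P := P) (j := j) (expMeanLogSU (n := Fin N))) n U₀) :=
        continuousAt_avgFun_of_small _ hsmall
      have hcont' : ContinuousAt (Averaging.iter (fun j => blockAvg (P := P) (j := j) (expMeanLogSU (n := Fin N))) (n + 1)) U₀ := by
        show ContinuousAt ((blockAvg (P := P) (j := n) (expMeanLogSU (n := Fin N))).avg ∘
          Averaging.iter (fun j => blockAvg (P := P) (j := j) (expMeanLogSU (n := Fin N))) n) U₀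
        rw [blockAvg_avg]
        exact hstep.comp hcont
      refine ⟨hcont', ?_⟩
      -- the level-`n` guard is open along `Ū⁽ⁿ⁾`
      have hn : ∀ᶠ U in 𝓝 U₀, ∀ c, Small (expMeanLogSU (n := Fin N))
          (Averaging.iter (fun j => blockAvg (P := P) (j := j) (expMeanLogSU (n := Fin N))) n U) c := by
        refine Filter.eventually_all.2 fun c => Filter.eventually_all.2 fun i => ?_
        have hf : ContinuousAt (fun U : GaugeField P 0 (SU N) =>
            dist1 (loopHol (Averaging.iter (fun j => blockAvg (P := P) (j := j) (expMeanLogSU (n := Fin N))) n U) c i)) U₀ :=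
          ((B12ContinuousTransportInvarianceOn.continuous_dist1_SU (N := N)).comp
            ((continuous_apply i).comp (BlockAveraging.continuous_loopHol (n := Fin N) c))).continuousAt.comp hcont
        exact hf.eventually (gt_mem_nhds (hsmall c i))
      filter_upwards [hev, hn] with U hU hUn
      intro j hj c
      rcases Nat.lt_succ_iff_lt_or_eq.1 hj with hjn | rfl
      · exact hU j hjn c
      · exact hUn c

end Guard

/-! ## §3 The ambient pivot field is `C^∞` in (family parameter, pivot log-coordinates) -/

section Ambient

variable {P : Params} {N : ℕ} [NeZero N]
variable {E : Type*} [NormedAddCommGroup E] [NormedSpace ℝ E]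

/-- The matrix field of the pivot-inserted configuration `(σ y)[βₙ c' ↦ Θ(X c')·U₀(βₙ c')]` is the ambient pivot field
`↑(σ y)[βₙ c' ↦ e^{X c'}·↑U₀(βₙ c')]`. [cite: Helgason2000, Ch. I §1 Thm. 1.14 (13) p. 96 (bookkeeping)] -/
theorem coeField_pivotInsert {n : ℕ} (U₀ : GaugeField P 0 (SU N)) (z : GaugeField P 0 (SU N)) (X : PBond P n → (specialUnitaryLogChart (Fin N)).lie) :
    coeField (extend (iterCentralBond n) (fun c' => (isChartRep_specialUnitaryGroup (n := Fin N)).expChart (X c') * U₀ (iterCentralBond n c')) z) =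
      extend (iterCentralBond n) (fun c' => NormedSpace.exp (((X c' : (specialUnitaryLogChart (Fin N)).lie) : Matrix (Fin N) (Fin N) ℂ)) *
        ((U₀ (iterCentralBond n c') : SU N) : Matrix (Fin N) (Fin N) ℂ)) (coeField z) := by
  have h := map_extend_eq (fun g : SU N => (g : Matrix (Fin N) (Fin N) ℂ)) (iterCentralBond n)
    (fun c' => (isChartRep_specialUnitaryGroup (n := Fin N)).expChart (X c') * U₀ (iterCentralBond n c')) z
  refine (show coeField _ = fun b => ((extend (iterCentralBond n) _ z b : SU N) : Matrix (Fin N) (Fin N) ℂ) from rfl).trans (h.trans ?_)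
  congr 1
  funext c'
  rw [Submonoid.coe_mul, Summit.QuantumFields.YangMills.BalabanUVNodes.N09ChartReadAveragingSmooth.coe_expChart]

/-- ★ **THE AMBIENT PIVOT FIELD IS `C^∞`** at `(0, 0)` in `(y, X)`: every bond coordinate is either `e^{X c'}·↑U₀(βₙ c')` (an entire function of one pivot
coordinate) or a coordinate of the smooth family `↑(σ y)`. [cite: Balaban1987RG1, p.253 («analytic function»; bookkeeping)] -/
theorem contDiffAt_ambientPivotField {n : ℕ} (U₀ : GaugeField P 0 (SU N)) (σ : E → GaugeField P 0 (SU N))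
    (hσs : ContDiffAt ℝ ⊤ (fun y => coeField (σ y)) 0) :
    ContDiffAt ℝ ⊤ (fun p : E × (PBond P n → (specialUnitaryLogChart (Fin N)).lie) =>
      extend (iterCentralBond n) (fun c' => NormedSpace.exp (((p.2 c' : (specialUnitaryLogChart (Fin N)).lie) : Matrix (Fin N) (Fin N) ℂ)) *
        ((U₀ (iterCentralBond n c') : SU N) : Matrix (Fin N) (Fin N) ℂ)) (coeField (σ p.1))) (0, 0) := by
  classical
  have hexp : ContDiff ℝ ⊤ (NormedSpace.exp : Matrix (Fin N) (Fin N) ℂ → Matrix (Fin N) (Fin N) ℂ) :=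
    contDiff_iff_contDiffAt.2 fun X => ((NormedSpace.exp_analytic (𝕂 := ℂ) X).contDiffAt).restrict_scalars ℝ
  refine contDiffAt_pi.2 fun b => ?_
  by_cases hb : ∃ c', iterCentralBond n c' = b
  · -- a pivot coordinate
    have hfun : (fun p : E × (PBond P n → (specialUnitaryLogChart (Fin N)).lie) =>
        extend (iterCentralBond n) (fun c' => NormedSpace.exp (((p.2 c' : (specialUnitaryLogChart (Fin N)).lie) : Matrix (Fin N) (Fin N) ℂ)) *
          ((U₀ (iterCentralBond n c') : SU N) : Matrix (Fin N) (Fin N) ℂ)) (coeField (σ p.1)) b) =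
        fun p => NormedSpace.exp (((p.2 (Classical.choose hb) : (specialUnitaryLogChart (Fin N)).lie) : Matrix (Fin N) (Fin N) ℂ)) *
          ((U₀ (iterCentralBond n (Classical.choose hb)) : SU N) : Matrix (Fin N) (Fin N) ℂ) := by
      funext p; rw [Function.extend_def, dif_pos hb]
    rw [hfun]
    have hval : ContDiff ℝ ⊤ (fun p : E × (PBond P n → (specialUnitaryLogChart (Fin N)).lie) =>
        ((p.2 (Classical.choose hb) : (specialUnitaryLogChart (Fin N)).lie) : Matrix (Fin N) (Fin N) ℂ)) :=
      ((specialUnitaryLogChart (Fin N)).lie.subtypeL.contDiff).comp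
        ((contDiff_apply ℝ ((specialUnitaryLogChart (Fin N)).lie) (Classical.choose hb)).comp contDiff_snd)
    exact ((hexp.comp hval).mul contDiff_const).contDiffAt
  · -- an environment coordinate
    have hfun : (fun p : E × (PBond P n → (specialUnitaryLogChart (Fin N)).lie) =>
        extend (iterCentralBond n) (fun c' => NormedSpace.exp (((p.2 c' : (specialUnitaryLogChart (Fin N)).lie) : Matrix (Fin N) (Fin N) ℂ)) *
          ((U₀ (iterCentralBond n c') : SU N) : Matrix (Fin N) (Fin N) ℂ)) (coeField (σ p.1)) b) =
        fun p => coeField (σ p.1) b := by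
      funext p; rw [Function.extend_def, dif_neg hb]
    rw [hfun]
    have h1 : ContDiffAt ℝ ⊤ (fun p : E × (PBond P n → (specialUnitaryLogChart (Fin N)).lie) => coeField (σ p.1)) (0, 0) :=
      ContDiffAt.comp (g := fun y => coeField (σ y)) (f := Prod.fst) ((0 : E), (0 : PBond P n → (specialUnitaryLogChart (Fin N)).lie))
        hσs contDiffAt_fst
    exact (contDiffAt_pi.1 h1) b

omit [NormedSpace ℝ E] in
/-- The pivot-inserted configuration depends continuously on `(y, X)` (in the configuration topology). [cite: Helgason2000, Ch. I §1 Thm. 1.14 p. 96 (bookkeeping)] -/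
theorem continuous_pivotInsert {n : ℕ} (U₀ : GaugeField P 0 (SU N)) (σ : E → GaugeField P 0 (SU N)) (hσc : Continuous σ) :
    Continuous (fun p : E × (PBond P n → (specialUnitaryLogChart (Fin N)).lie) =>
      extend (iterCentralBond n) (fun c' => (isChartRep_specialUnitaryGroup (n := Fin N)).expChart (p.2 c') * U₀ (iterCentralBond n c')) (σ p.1)) := by
  classical
  refine continuous_pi fun b => ?_
  by_cases hb : ∃ c', iterCentralBond n c' = b
  · have hfun : (fun p : E × (PBond P n → (specialUnitaryLogChart (Fin N)).lie) =>
        extend (iterCentralBond n) (fun c' => (isChartRep_specialUnitaryGroup (n := Fin N)).expChart (p.2 c') * U₀ (iterCentralBond n c')) (σ p.1) b) =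
        fun p => (isChartRep_specialUnitaryGroup (n := Fin N)).expChart (p.2 (Classical.choose hb)) * U₀ (iterCentralBond n (Classical.choose hb)) := by
      funext p; rw [Function.extend_def, dif_pos hb]
    rw [hfun]
    exact ((isChartRep_specialUnitaryGroup (n := Fin N)).continuous_expChart.comp
      ((continuous_apply (Classical.choose hb)).comp continuous_snd)).mul continuous_const
  · have hfun : (fun p : E × (PBond P n → (specialUnitaryLogChart (Fin N)).lie) =>
        extend (iterCentralBond n) (fun c' => (isChartRep_specialUnitaryGroup (n := Fin N)).expChart (p.2 c') * U₀ (iterCentralBond n c')) (σ p.1) b) =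
        fun p => σ p.1 b := by
      funext p; rw [Function.extend_def, dif_neg hb]
    rw [hfun]
    exact (continuous_apply b).comp (hσc.comp continuous_fst)

/-- At `(y, X) = (0, 0)` the pivot-inserted configuration is `U₀` itself (`Θ 0 = 1`, `σ 0 = U₀`). [cite: Helgason2000, Ch. I §1 Thm. 1.14 p. 96 (bookkeeping)] -/
theorem pivotInsert_zero {n : ℕ} (U₀ : GaugeField P 0 (SU N)) :
    extend (iterCentralBond n) (fun c' => (isChartRep_specialUnitaryGroup (n := Fin N)).expChart
        ((0 : PBond P n → (specialUnitaryLogChart (Fin N)).lie) c') * U₀ (iterCentralBond n c')) U₀ = U₀ := by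
  have h : (fun c' => (isChartRep_specialUnitaryGroup (n := Fin N)).expChart
      ((0 : PBond P n → (specialUnitaryLogChart (Fin N)).lie) c') * U₀ (iterCentralBond n c')) = fun c' => U₀ (iterCentralBond n c') := by
    funext c'; rw [Pi.zero_apply, (isChartRep_specialUnitaryGroup (n := Fin N)).expChart_zero, one_mul]
  rw [h, extend_comp_apply_self]

end Ambient

/-! ## §4 The pivot-read of the iterated averaging is `C^∞` at `(0, 0)` along a smooth family -/

section Main

variable {P : Params} {N : ℕ} [NeZero N]
variable {E : Type*} [NormedAddCommGroup E] [NormedSpace ℝ E]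

/-- ★★ **(C2-a) THE PIVOT-READ IS JOINTLY `C^∞`.**  Let `U₀` satisfy the (0.4) guard below level `n`, and let `σ` be a continuous family through `σ 0 = U₀` whose matrix
field `y ↦ ↑(σ y)` is `C^∞` at `0`.  Then the pivot-read of the `n`-fold averaging,
`(y, X) ↦ (c ↦ Λ(Ū⁽ⁿ⁾((σ y)[βₙ c' ↦ Θ(X c')·U₀(βₙ c')]) c · (Ū⁽ⁿ⁾ U₀ c)⁻¹))`, is `C^∞` at `(0, 0)`: near `(0,0)` the inserted configuration stays in the (open)
guard, so the matrix of `Ū⁽ⁿ⁾` of it is the smooth ambient iterate `iterM n` of the smooth ambient pivot field (lit ✓`coeField_iter_eq_iterM`, ✓`contDiffAt_iterM`), the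
relative matrix `iterM n (…) c · (↑Ū⁽ⁿ⁾U₀ c)⋆` tends to `1`, where `Λ` reads `mlog` (✓`coe_logChart`), analytic at `1`; a `𝔰𝔲(N)`-valued map is smooth iff its
matrix is (✓`contDiffAt_of_coe`). [cite: Balaban1987RG1, (0.4) p.253 («analytic function») and (0.21) p.256] [cite: Dieudonne1960, Ch. X §2 (10.2.1)] -/
theorem contDiffAt_pivotRead {n : ℕ} (U₀ : GaugeField P 0 (SU N))
    (hU₀ : SmallBelow (fun j => blockAvg (P := P) (j := j) (expMeanLogSU (n := Fin N))) n U₀)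
    (σ : E → GaugeField P 0 (SU N)) (hσc : Continuous σ) (hσ0 : σ 0 = U₀) (hσs : ContDiffAt ℝ ⊤ (fun y => coeField (σ y)) 0) :
    ContDiffAt ℝ ⊤ (fun p : E × (PBond P n → (specialUnitaryLogChart (Fin N)).lie) => fun c : PBond P n =>
      (isChartRep_specialUnitaryGroup (n := Fin N)).logChart
        (Averaging.iter (fun j => blockAvg (P := P) (j := j) (expMeanLogSU (n := Fin N))) n
            (extend (iterCentralBond n) (fun c' => (isChartRep_specialUnitaryGroup (n := Fin N)).expChart (p.2 c') * U₀ (iterCentralBond n c')) (σ p.1)) c *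
          (Averaging.iter (fun j => blockAvg (P := P) (j := j) (expMeanLogSU (n := Fin N))) n U₀ c)⁻¹)) (0, 0) := by
  classical
  set h := isChartRep_specialUnitaryGroup (n := Fin N) with hh
  -- the inserted configuration `Wp`, its ambient matrix field `F`, the ambient iterate
  set Wp : E × (PBond P n → (specialUnitaryLogChart (Fin N)).lie) → GaugeField P 0 (SU N) :=
    fun p => extend (iterCentralBond n) (fun c' => h.expChart (p.2 c') * U₀ (iterCentralBond n c')) (σ p.1) with hWp
  set F : E × (PBond P n → (specialUnitaryLogChart (Fin N)).lie) → PBond P 0 → Matrix (Fin N) (Fin N) ℂ :=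
    fun p => extend (iterCentralBond n) (fun c' => NormedSpace.exp (((p.2 c' : (specialUnitaryLogChart (Fin N)).lie) : Matrix (Fin N) (Fin N) ℂ)) *
      ((U₀ (iterCentralBond n c') : SU N) : Matrix (Fin N) (Fin N) ℂ)) (coeField (σ p.1)) with hF
  have hcoeW : ∀ p, coeField (Wp p) = F p := fun p => coeField_pivotInsert U₀ (σ p.1) p.2
  have hW0 : Wp (0, 0) = U₀ := by
    show extend (iterCentralBond n) (fun c' => h.expChart ((0 : PBond P n → (specialUnitaryLogChart (Fin N)).lie) c') * U₀ (iterCentralBond n c')) (σ 0) = U₀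
    rw [hσ0]; exact pivotInsert_zero U₀
  have hF0 : F (0, 0) = coeField U₀ := by rw [← hcoeW, hW0]
  have hFs : ContDiffAt ℝ ⊤ F (0, 0) := contDiffAt_ambientPivotField U₀ σ hσs
  have hWc : Continuous Wp := continuous_pivotInsert U₀ σ hσc
  -- the guard holds near `(0,0)`
  obtain ⟨hitc, hgev⟩ := continuousAt_iter_and_eventually_smallBelow n U₀ hU₀
  have hguard : ∀ᶠ p in 𝓝 ((0 : E), (0 : PBond P n → (specialUnitaryLogChart (Fin N)).lie)),
      SmallBelow (fun j => blockAvg (P := P) (j := j) (expMeanLogSU (n := Fin N))) n (Wp p) := by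
    have ht : Tendsto Wp (𝓝 (0, 0)) (𝓝 U₀) := by rw [← hW0]; exact hWc.continuousAt
    exact ht.eventually hgev
  -- the ambient iterate is smooth at `(0,0)`
  have hiter : ContDiffAt ℝ ⊤ (fun p => iterM n (F p)) ((0 : E), (0 : PBond P n → (specialUnitaryLogChart (Fin N)).lie)) := by
    have hg : ContDiffAt ℝ ⊤ (iterM n : (PBond P 0 → Matrix (Fin N) (Fin N) ℂ) → PBond P n → Matrix (Fin N) (Fin N) ℂ) (F (0, 0)) := by
      rw [hF0]; exact contDiffAt_iterM n hU₀
    exact hg.comp (0, 0) hFs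
  -- the matrix of `Ū⁽ⁿ⁾ U₀`
  have hcoe0 : coeField (Averaging.iter (fun j => blockAvg (P := P) (j := j) (expMeanLogSU (n := Fin N))) n U₀) = iterM n (coeField U₀) :=
    coeField_iter_eq_iterM n hU₀
  refine contDiffAt_pi.2 fun c => contDiffAt_of_coe (specialUnitaryLogChart (Fin N)).lie ?_
  -- the smooth model of the `c`-component: `mlog (iterM n (F p) c · (↑Ū⁽ⁿ⁾U₀ c)⋆)`
  set s : Matrix (Fin N) (Fin N) ℂ :=
    star ((Averaging.iter (fun j => blockAvg (P := P) (j := j) (expMeanLogSU (n := Fin N))) n U₀ c : SU N) : Matrix (Fin N) (Fin N) ℂ) with hs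
  have hM : ContDiffAt ℝ ⊤ (fun p => iterM n (F p) c * s) ((0 : E), (0 : PBond P n → (specialUnitaryLogChart (Fin N)).lie)) :=
    ((contDiffAt_pi.1 hiter) c).mul contDiffAt_const
  have hM0 : iterM n (F (0, 0)) c * s = 1 := by
    rw [hF0, ← hcoe0, hs]
    exact coe_mul_star_coe_SU _
  have hmlog : ContDiffAt ℝ ⊤ (fun p => mlog (iterM n (F p) c * s)) ((0 : E), (0 : PBond P n → (specialUnitaryLogChart (Fin N)).lie)) := by
    have ha : ContDiffAt ℝ ⊤ (fun Y : Matrix (Fin N) (Fin N) ℂ => mlog Y) (iterM n (F (0, 0)) c * s) := by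
      rw [hM0]
      exact ((analyticAt_mlog (X := (1 : Matrix (Fin N) (Fin N) ℂ)) (by simp)).contDiffAt).restrict_scalars ℝ
    exact ContDiffAt.comp (g := fun Y : Matrix (Fin N) (Fin N) ℂ => mlog Y) (f := fun p => iterM n (F p) c * s)
      ((0 : E), (0 : PBond P n → (specialUnitaryLogChart (Fin N)).lie)) ha hM
  -- near `(0,0)` the relative matrix is inside the logarithmic chart
  have hnear : ∀ᶠ p in 𝓝 ((0 : E), (0 : PBond P n → (specialUnitaryLogChart (Fin N)).lie)),
      ‖iterM n (F p) c * s - 1‖ < innerRadius (specialUnitaryLogChart (Fin N)) := by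
    have hc : ContinuousAt (fun p => ‖iterM n (F p) c * s - 1‖) ((0 : E), (0 : PBond P n → (specialUnitaryLogChart (Fin N)).lie)) :=
      continuous_norm.continuousAt.comp (hM.continuousAt.sub continuousAt_const)
    refine hc.eventually (isOpen_Iio.mem_nhds ?_)
    show ‖iterM n (F (0, 0)) c * s - 1‖ < _
    rw [hM0, sub_self, norm_zero]; exact innerRadius_pos
  -- identification of the coercion with the smooth model near `(0,0)`
  have heq : (fun p => ((h.logChart
      (Averaging.iter (fun j => blockAvg (P := P) (j := j) (expMeanLogSU (n := Fin N))) n (Wp p) c *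
        (Averaging.iter (fun j => blockAvg (P := P) (j := j) (expMeanLogSU (n := Fin N))) n U₀ c)⁻¹) : (specialUnitaryLogChart (Fin N)).lie) :
          Matrix (Fin N) (Fin N) ℂ)) =ᶠ[𝓝 ((0 : E), (0 : PBond P n → (specialUnitaryLogChart (Fin N)).lie))]
      fun p => mlog (iterM n (F p) c * s) := by
    filter_upwards [hguard, hnear] with p hp hpn
    have hcoeI : ((Averaging.iter (fun j => blockAvg (P := P) (j := j) (expMeanLogSU (n := Fin N))) n (Wp p) c : SU N) : Matrix (Fin N) (Fin N) ℂ) =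
        iterM n (F p) c := by
      rw [← hcoeW p, ← coeField_iter_eq_iterM n hp]; rfl
    have hrel : ((Averaging.iter (fun j => blockAvg (P := P) (j := j) (expMeanLogSU (n := Fin N))) n (Wp p) c *
        (Averaging.iter (fun j => blockAvg (P := P) (j := j) (expMeanLogSU (n := Fin N))) n U₀ c)⁻¹ : SU N) : Matrix (Fin N) (Fin N) ℂ) =
        iterM n (F p) c * s := by
      rw [Submonoid.coe_mul, coe_inv_SU, hcoeI]
    have hρ : ‖fundamentalRep (Fin N) (Averaging.iter (fun j => blockAvg (P := P) (j := j) (expMeanLogSU (n := Fin N))) n (Wp p) c *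
        (Averaging.iter (fun j => blockAvg (P := P) (j := j) (expMeanLogSU (n := Fin N))) n U₀ c)⁻¹) - 1‖ <
          innerRadius (specialUnitaryLogChart (Fin N)) := by
      rw [fundamentalRep_apply, hrel]; exact hpn
    rw [h.coe_logChart hρ, fundamentalRep_apply, hrel]
  exact hmlog.congr_of_eventuallyEq heq

/-- **THE PIVOT-READ VANISHES AT THE BASE POINT**: at `X = 0` in the environment `U₀` the inserted configuration is `U₀`, so every component reads `Λ(1) = 0`.
[cite: Balaban1987RG1, (0.21) p.256 (bookkeeping)] -/
theorem pivotRead_base_zero {n : ℕ} (U₀ : GaugeField P 0 (SU N)) (c : PBond P n) :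
    (isChartRep_specialUnitaryGroup (n := Fin N)).logChart
        (Averaging.iter (fun j => blockAvg (P := P) (j := j) (expMeanLogSU (n := Fin N))) n
            (extend (iterCentralBond n) (fun c' => (isChartRep_specialUnitaryGroup (n := Fin N)).expChart
              ((0 : PBond P n → (specialUnitaryLogChart (Fin N)).lie) c') * U₀ (iterCentralBond n c')) U₀) c *
          (Averaging.iter (fun j => blockAvg (P := P) (j := j) (expMeanLogSU (n := Fin N))) n U₀ c)⁻¹) = 0 := by
  rw [pivotInsert_zero, mul_inv_cancel, (isChartRep_specialUnitaryGroup (n := Fin N)).logChart_one]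

end Main

/-! ## §5 The docking identity for (C2-b): in the environment `U₀` the pivot-read is px11's one-variable chart-read chain, bond by bond -/

section Dock

variable {P : Params} {N : ℕ} [NeZero N]

/-- **TRIANGULARITY**: with all pivots inserted into the environment `U₀`, the coarse bond `c` of `Ū⁽ⁿ⁾` sees ONLY its own pivot `βₙ c` — `Ū⁽ⁿ⁾(U₀[βₙ ↦ g]) c =
chainMap ℰ n U₀ c (g c)` (✓`isLocal_iter_blockAvg` ∘ ✓`apply_resample_eq`). [cite: Balaban1987RG1, p.267 (after (2.10))] -/
theorem iter_extend_apply_eq_chainMap {G : Type*} [GaugeGroup G] (ℰ : LoopAverage G) {n : ℕ} (hn : n ≤ P.m + P.K)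
    (U₀ : GaugeField P 0 G) (g : PBond P n → G) (c : PBond P n) :
    Averaging.iter (fun j => blockAvg (P := P) (j := j) ℰ) n (extend (iterCentralBond n) g U₀) c = chainMap ℰ n U₀ c (g c) := by
  classical
  rw [apply_resample_eq (isLocal_iter_blockAvg (P := P) ℰ hn) (iterCentralBond_injective hn) U₀ g c]
  rfl

/-- ★ **THE DOCKING IDENTITY**: in the environment `U₀`, the `c`-component of the pivot-read at `X` is the one-variable chart-read chain of the bond `c` at `X c`,
`Λ(chainMap ℰ n U₀ c (Θ(X c)·U₀(βₙ c)) · (Ū⁽ⁿ⁾ U₀ c)⁻¹)` — so the pivot-derivative of the read at `0` is block-diagonal over the coarse bonds, with blocks the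
derivatives of the one-bond chains ((C2-b), px11 g10). [cite: Balaban1987RG1, p.267 (after (2.10))] -/
theorem pivotRead_base_eq_chainMap {n : ℕ} (hn : n ≤ P.m + P.K) (U₀ : GaugeField P 0 (SU N))
    (X : PBond P n → (specialUnitaryLogChart (Fin N)).lie) (c : PBond P n) :
    (isChartRep_specialUnitaryGroup (n := Fin N)).logChart
        (Averaging.iter (fun j => blockAvg (P := P) (j := j) (expMeanLogSU (n := Fin N))) n
            (extend (iterCentralBond n) (fun c' => (isChartRep_specialUnitaryGroup (n := Fin N)).expChart (X c') * U₀ (iterCentralBond n c')) U₀) c *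
          (Averaging.iter (fun j => blockAvg (P := P) (j := j) (expMeanLogSU (n := Fin N))) n U₀ c)⁻¹) =
      (isChartRep_specialUnitaryGroup (n := Fin N)).logChart
        (chainMap (expMeanLogSU (n := Fin N)) n U₀ c ((isChartRep_specialUnitaryGroup (n := Fin N)).expChart (X c) * U₀ (iterCentralBond n c)) *
          (Averaging.iter (fun j => blockAvg (P := P) (j := j) (expMeanLogSU (n := Fin N))) n U₀ c)⁻¹) := by
  rw [iter_extend_apply_eq_chainMap (expMeanLogSU (n := Fin N)) hn U₀ _ c]

/-- **THE COMPONENTS OF THE PIVOT-READ IN THE ENVIRONMENT `U₀` DEPEND ON THEIR OWN PIVOT COORDINATE ONLY**: two coordinate vectors agreeing at `c` give the same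
`c`-component. [cite: Balaban1987RG1, p.267 (after (2.10))] -/
theorem pivotRead_base_apply_congr {n : ℕ} (hn : n ≤ P.m + P.K) (U₀ : GaugeField P 0 (SU N))
    {X X' : PBond P n → (specialUnitaryLogChart (Fin N)).lie} {c : PBond P n} (hXX' : X c = X' c) :
    (isChartRep_specialUnitaryGroup (n := Fin N)).logChart
        (Averaging.iter (fun j => blockAvg (P := P) (j := j) (expMeanLogSU (n := Fin N))) n
            (extend (iterCentralBond n) (fun c' => (isChartRep_specialUnitaryGroup (n := Fin N)).expChart (X c') * U₀ (iterCentralBond n c')) U₀) c *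
          (Averaging.iter (fun j => blockAvg (P := P) (j := j) (expMeanLogSU (n := Fin N))) n U₀ c)⁻¹) =
      (isChartRep_specialUnitaryGroup (n := Fin N)).logChart
        (Averaging.iter (fun j => blockAvg (P := P) (j := j) (expMeanLogSU (n := Fin N))) n
            (extend (iterCentralBond n) (fun c' => (isChartRep_specialUnitaryGroup (n := Fin N)).expChart (X' c') * U₀ (iterCentralBond n c')) U₀) c *
          (Averaging.iter (fun j => blockAvg (P := P) (j := j) (expMeanLogSU (n := Fin N))) n U₀ c)⁻¹) := by
  rw [pivotRead_base_eq_chainMap hn, pivotRead_base_eq_chainMap hn, hXX']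

end Dock

end Summit.QuantumFields.YangMills.Theorems.FluctuationComparisonRegPrIntLS2BetaPivotReadSmooth

end
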